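import Summits.Ventures.CertifiedArithmetic.LowPrec.DoubleRoundingFMANearWideCore
import Summits.Ventures.CertifiedArithmetic.LowPrec.DoubleRoundingFMAWideIff

/-!
# Double rounding of the FMA through a register with `P_ψ = 3 P_φ - 1` — the witnesses

HONEST FRAMING: certified error envelopes and provably optimal rounding/accumulation schemes for
low-precision formats under stated cost models; every table by two implementations; no hardware
or vendor claims.

THEOREM D-fma-W′, converse half: the two NEW slip patterns of the register width
`m_ψ = 3 m_φ + 1` are realized by data of `φ` whenever the record-level test sees them.

* §1 (A2) `not_dFma_of_twoSigTest_tie`: if the A2 number `fmaTieSig m t` of an available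
  midpoint `μ = (2t+1)·2^(2m+1)` quanta of the binade `2^(m_ψ+1)` quanta is a product `a₁·b₁` of
  two significands, the data `a = a₁·2^P` quanta, `b = b₁` (the integer), `c = ±(2^P - 1)` quanta
  give `a·b + c = μ ∓ quantum φ`, one half-spacing of `ψ` off the midpoint on the side the parity
  of `t` makes harmful: `fl_ψ` returns the (even) midpoint and the tie of `φ` then goes the wrong
  way (`DoubleRoundingGmidBelow.lean` §2, `DoubleRoundingGmidTieBelow.lean`).
* §2 (B′) `not_dFma_of_twoSigTest_finer`: if `2^(2P-1) ∓ 1 = a₁·b₁` and the binade `k` of `φ`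
  with `k + bias = s + m + 2` has its second value finite, the data `a = ∓a₁·2^s` quanta,
  `b = b₁` quanta (a product FINER than the quantum of `φ`: `quantum φ² = 2^S quantum ψ`) and
  `c =` the upper (resp. lower) neighbour of the midpoint `μ = (2^P+1)·2^k` quanta give
  `a·b + c = μ + δ` with `2δ` the spacing of `ψ` at `μ`: the same tie mechanism slips
  (`t = 2^m` even).

Realizability (ranges of `a`, `b`) is bookkept by the hypotheses `hR`, `hu`, `has`; the
record-level converse and the `iff` are `DoubleRoundingFMANearWideIff.lean`.  Implementation A =
`code/enum/fma_nearwide_law.py` (law replay: every triple named here slips, exact rationals).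

References: [BoldoMelquiond2008] Thm 3; [MartinDorelMelquiondMuller2013] Property 2.1;
[Roux2014] §2; [Figueroa1995] §3.  No hardware or vendor claims.
-/

namespace Summit.Ventures.CertifiedArithmetic

open Literature.ComputerArithmetic.FloatingPoint
open Literature.ComputerArithmetic.FloatingPoint.Format
open Literature.ComputerArithmetic.FloatingPoint.MiniFloat

/-! ## §0 Reading the two-significand test -/

/-- A passing `twoSigTest P n` names a factorization `n = a₁·b₁` with `0 < a₁ < 2^P`,
`b₁ < 2^P`. [folklore] -/
theorem exists_mul_of_twoSigTest {P n : ℕ} (h : twoSigTest P n = true) :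
    ∃ a₁ b₁ : ℕ, 0 < a₁ ∧ a₁ < 2 ^ P ∧ b₁ < 2 ^ P ∧ n = a₁ * b₁ := by
  unfold twoSigTest at h
  obtain ⟨a₁, ha₁m, ha₁⟩ := List.any_eq_true.mp h
  rw [List.mem_range] at ha₁m
  simp only [Bool.and_eq_true, decide_eq_true_eq] at ha₁
  obtain ⟨⟨ha0, hmod⟩, hlt⟩ := ha₁
  obtain ⟨b₁, hab⟩ : a₁ ∣ n := Nat.dvd_of_mod_eq_zero hmod
  refine ⟨a₁, b₁, ha0, ha₁m, ?_, hab⟩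
  rw [hab] at hlt
  exact Nat.lt_of_mul_lt_mul_left hlt

/-! ## §1 Pattern (A2): a tie of `ψ` one half-spacing off an available midpoint -/

/-- THE A2 DATA of a record `φ` with `bias ≥ 1`: `a = a₁·2^P` quanta, `b = b₁` (the integer) and
`c = 2^P - 1` quanta, for significands `1 ≤ a₁`, `b₁ < 2^P` in range. [this packet] -/
theorem exists_nearWideA_data {φ : Format} (hb : 1 ≤ φ.bias) {a₁ b₁ : ℕ} (h1a : 1 ≤ a₁)
    (ha : a₁ < 2 ^ (φ.manBits + 1)) (hb₁ : b₁ < 2 ^ (φ.manBits + 1))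
    (hak : a₁ * 2 ^ (φ.manBits + 1) ≤ φ.maxScaled)
    (hbk : b₁ * 2 ^ (φ.manBits + (φ.bias - 1)) ≤ φ.maxScaled) :
    ∃ a b c : MiniFloat φ,
      a.toRat * b.toRat = ((a₁ * b₁ * 2 ^ (φ.manBits + 1) : ℕ) : ℚ) * φ.quantum ∧
      c.toRat = ((2 ^ (φ.manBits + 1) - 1 : ℕ) : ℚ) * φ.quantum := by
  obtain ⟨a, b, -, hab, -⟩ := exists_fmaWide_data hb h1a ha hb₁ hak hbk
  have hle : 2 ^ (φ.manBits + 1) - 1 ≤ φ.maxScaled :=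
    le_trans (Nat.sub_le _ _) (le_trans (Nat.le_mul_of_pos_left _ h1a) hak)
  obtain ⟨c, hc⟩ := exists_toRat_eq_natMul
    (representable_of_lt_pow (φ := φ) (Nat.sub_lt (Nat.two_pow_pos _) Nat.one_pos) hle)
  exact ⟨a, b, c, hab, hc⟩

/-- PATTERN (A2) REFUTES `DFma`: for records `φ ⊆ ψ` (`hq`, `hM`) with `m_ψ = 3 m_φ + 1`,
`m_φ ≥ 1`, `bias φ ≥ 1` and the range hypothesis `hR`, a midpoint of `φ` of the binade
`2^(m_ψ+1)` quanta that is finite in `φ` (`hu`) and whose A2 number `fmaTieSig m (2^m + j)`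
passes `twoSigTest` refutes `DFma φ ψ`: `a = a₁·2^P`, `b = b₁`, `c = ±(2^P - 1)` quanta slip.
[this packet] -/
theorem not_dFma_of_twoSigTest_tie {φ ψ : Format} (hq : ψ.qexp ≤ φ.qexp)
    (hM : φ.maxScaled * 2 ^ (φ.qexp - ψ.qexp).toNat ≤ ψ.maxScaled) (h1 : 1 ≤ φ.manBits)
    (hb : 1 ≤ φ.bias) (hm : ψ.manBits = 3 * φ.manBits + 1)
    (hR : φ.bias + 2 * φ.manBits ≤ ψ.manBits + 1 ∨ 2 ^ (φ.bias + 2 * φ.manBits) ≤ φ.maxScaled)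
    {j : ℕ} (hj : j < 2 ^ φ.manBits)
    (hu : (2 ^ φ.manBits + j + 1) * 2 ^ ((2 * φ.manBits + 1) + 1) ≤ φ.maxScaled)
    (hs : twoSigTest (φ.manBits + 1) (fmaTieSig φ.manBits (2 ^ φ.manBits + j)) = true) :
    ¬ DFma φ ψ := by
  set t := 2 ^ φ.manBits + j with htdef
  obtain ⟨a₁, b₁, ha0, ha₁lt, hb₁lt, hab⟩ := exists_mul_of_twoSigTest hs
  -- range bookkeeping
  have htlo : 2 ^ φ.manBits ≤ t := by omega
  have hthi : t < 2 ^ (φ.manBits + 1) := by rw [pow_succ]; omega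
  have h22 : 2 ^ (φ.manBits + 1) * 2 ^ (φ.manBits + 1) = 2 ^ ((2 * φ.manBits + 1) + 1) := by
    rw [← pow_add]; congr 1; omega
  have hak : a₁ * 2 ^ (φ.manBits + 1) ≤ φ.maxScaled := by
    refine le_trans ?_ hu
    calc a₁ * 2 ^ (φ.manBits + 1) ≤ 2 ^ (φ.manBits + 1) * 2 ^ (φ.manBits + 1) :=
          Nat.mul_le_mul_right _ ha₁lt.le
      _ = 1 * 2 ^ ((2 * φ.manBits + 1) + 1) := by rw [h22, one_mul]
      _ ≤ (2 ^ φ.manBits + j + 1) * 2 ^ ((2 * φ.manBits + 1) + 1) :=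
          Nat.mul_le_mul_right _ (by omega)
  have hbk : b₁ * 2 ^ (φ.manBits + (φ.bias - 1)) ≤ φ.maxScaled := by
    have h2 : b₁ * 2 ^ (φ.manBits + (φ.bias - 1)) ≤ 2 ^ (φ.bias + 2 * φ.manBits) := by
      calc b₁ * 2 ^ (φ.manBits + (φ.bias - 1))
          ≤ 2 ^ (φ.manBits + 1) * 2 ^ (φ.manBits + (φ.bias - 1)) :=
            Nat.mul_le_mul_right _ hb₁lt.le
        _ = 2 ^ (φ.bias + 2 * φ.manBits) := by rw [← pow_add]; congr 1; omega
    rcases hR with hR | hR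
    · refine le_trans h2 (le_trans ?_ hu)
      calc 2 ^ (φ.bias + 2 * φ.manBits) ≤ 2 ^ (φ.manBits + ((2 * φ.manBits + 1) + 1)) :=
            Nat.pow_le_pow_right (by norm_num) (by omega)
        _ = 2 ^ φ.manBits * 2 ^ ((2 * φ.manBits + 1) + 1) := pow_add _ _ _
        _ ≤ (t + 1) * 2 ^ ((2 * φ.manBits + 1) + 1) := Nat.mul_le_mul_right _ (by omega)
    · exact le_trans h2 hR
  obtain ⟨a, b, c, habq, hcq⟩ := exists_nearWideA_data hb ha0 ha₁lt hb₁lt hak hbk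
  rw [← hab] at habq
  -- the tie of `ψ` at `μ ∓ quantum φ`
  set d := (φ.qexp - ψ.qexp).toNat with hd
  have hk' : ψ.manBits ≤ φ.manBits + (2 * φ.manBits + 1) + d := by omega
  have hP2 : φ.manBits + 2 ≤ ψ.manBits := by omega
  have hδψ : 2 * φ.quantum
      = 2 ^ (φ.manBits + (2 * φ.manBits + 1) + d + 1 - ψ.manBits) * ψ.quantum := by
    rw [show φ.manBits + (2 * φ.manBits + 1) + d + 1 - ψ.manBits = d + 1 by omega, pow_succ,
      quantum_eq_two_pow_mul hq]
    ring
  have h2p : ((2 ^ (φ.manBits + 1) - 1 : ℕ) : ℚ) = 2 ^ (φ.manBits + 1) - 1 := by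
    rw [Nat.cast_sub Nat.one_le_two_pow]; push_cast; ring
  have hTie := fmaTieSig_eq φ.manBits t
  intro hD
  rcases Nat.even_or_odd t with ht | ht
  · -- `t` even: `fmaTieSig = (2t+1)·2^m + 1`, `c = -(2^P - 1)`: `x = μ + quantum φ`
    rw [if_neg (by rw [Nat.even_iff.mp ht]; omega)] at hTie
    have hn : ((fmaTieSig φ.manBits t : ℕ) : ℚ) = (2 * t + 1) * 2 ^ φ.manBits + 1 := by
      have h2 : ((fmaTieSig φ.manBits t : ℕ) : ℤ) = (2 * t + 1) * 2 ^ φ.manBits + 1 := by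
        rw [hTie]; ring
      exact_mod_cast h2
    have e : ((fmaTieSig φ.manBits t * 2 ^ (φ.manBits + 1) : ℕ) : ℚ) * φ.quantum
          + -(((2 ^ (φ.manBits + 1) - 1 : ℕ) : ℚ) * φ.quantum)
        = (((2 * t + 1) * 2 ^ (2 * φ.manBits + 1) : ℕ) : ℚ) * φ.quantum + φ.quantum := by
      rw [Nat.cast_mul, hn, h2p]; push_cast; ring
    have h' := hD a b c.flipSign
    rw [toRat_flipSign, habq, hcq, ← sub_eq_add_neg, sub_eq_add_neg, e] at h'
    exact roundNE_roundNE_ne_gmid_tie hq hM h1 hP2 ht htlo hthi hu hk' hδψ h'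
  · -- `t` odd: `fmaTieSig = (2t+1)·2^m - 1`, `c = +(2^P - 1)`: `x = μ - quantum φ`
    rw [if_pos (Nat.odd_iff.mp ht)] at hTie
    have hn : ((fmaTieSig φ.manBits t : ℕ) : ℚ) = (2 * t + 1) * 2 ^ φ.manBits - 1 := by
      exact_mod_cast hTie
    have e : ((fmaTieSig φ.manBits t * 2 ^ (φ.manBits + 1) : ℕ) : ℚ) * φ.quantum
          + ((2 ^ (φ.manBits + 1) - 1 : ℕ) : ℚ) * φ.quantum
        = (((2 * t + 1) * 2 ^ (2 * φ.manBits + 1) : ℕ) : ℚ) * φ.quantum - φ.quantum := by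
      rw [Nat.cast_mul, hn, h2p]; push_cast; ring
    have h' := hD a b c
    rw [habq, hcq, e] at h'
    exact roundNE_roundNE_ne_gmid_tie_below hq hM h1 hP2 ht htlo hthi hu hk' hδψ h'

/-! ## §2 Pattern (B′): a product finer than the quantum of `φ` -/

/-- PATTERN (B′) REFUTES `DFma`: for records `φ ⊆ ψ` (`hq`, `hM`) with `m_ψ = 3 m_φ + 1`,
`L_ψ ≤ 2 L_φ`, `L_ψ + P_ψ ≤ L_φ`, `m_φ ≥ 1`, a factorization `2^(2P_φ-1) ∓ 1 = a₁·b₁` into two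
significands together with a binade `k` of `φ` with `k + bias = s + m + 2`, second value
`(2^m+1)·2^(k+1)` finite and room `2^(P+s) ≤ maxScaled` refutes `DFma φ ψ`: `a = ∓a₁·2^s`,
`b = b₁` quanta, `c` = the upper (resp. lower) neighbour of the midpoint `(2^P+1)·2^k` slip.
[this packet] -/
theorem not_dFma_of_twoSigTest_finer {φ ψ : Format} (hq : ψ.qexp ≤ φ.qexp)
    (hq2 : ψ.qexp ≤ 2 * φ.qexp)
    (hM : φ.maxScaled * 2 ^ (φ.qexp - ψ.qexp).toNat ≤ ψ.maxScaled) (h1 : 1 ≤ φ.manBits)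
    (hm : ψ.manBits = 3 * φ.manBits + 1) (hnorm : ψ.qexp + ψ.manBits + 1 ≤ φ.qexp)
    {k s : ℕ} (hks : k + φ.bias = s + φ.manBits + 2)
    (hu : (2 ^ φ.manBits + 1) * 2 ^ (k + 1) ≤ φ.maxScaled)
    (has : 2 ^ (φ.manBits + 1) * 2 ^ s ≤ φ.maxScaled)
    (hs : (twoSigTest (φ.manBits + 1) (2 ^ (2 * (φ.manBits + 1) - 1) - 1)
      || twoSigTest (φ.manBits + 1) (2 ^ (2 * (φ.manBits + 1) - 1) + 1)) = true) :
    ¬ DFma φ ψ := by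
  have hQφ := φ.quantum_pos
  have hQ := ψ.quantum_pos
  -- quanta: `quantum φ = 2^(3m+2+D') quantum ψ`, `quantum φ² = 2^S quantum ψ`
  have hD0 : (((φ.qexp - ψ.qexp).toNat : ℕ) : ℤ) = φ.qexp - ψ.qexp := Int.toNat_of_nonneg (by omega)
  obtain ⟨D', hD'⟩ : ∃ D' : ℕ, (φ.qexp - ψ.qexp).toNat = 3 * φ.manBits + 2 + D' :=
    ⟨(φ.qexp - ψ.qexp).toNat - (3 * φ.manBits + 2), by omega⟩
  have hDq : φ.quantum = 2 ^ (3 * φ.manBits + 2 + D') * ψ.quantum := by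
    rw [← hD']; exact quantum_eq_two_pow_mul hq
  set S := (2 * φ.qexp - ψ.qexp).toNat with hSdef
  have hS0 : ((S : ℕ) : ℤ) = 2 * φ.qexp - ψ.qexp := by
    rw [hSdef]; exact Int.toNat_of_nonneg (by omega)
  have hSq : φ.quantum * φ.quantum = 2 ^ S * ψ.quantum := by
    unfold Format.quantum
    rw [← zpow_natCast, ← zpow_add₀ two_ne_zero, ← zpow_add₀ two_ne_zero, hS0]
    congr 1; ring
  have hqφ : φ.qexp = 1 - (φ.bias : ℤ) - φ.manBits := rfl
  have hsS : (2:ℚ) ^ s * 2 ^ S = 2 ^ (φ.manBits + k + D' + 1) := by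
    rw [← pow_add]; congr 1; omega
  -- the tie frame at `μ = (2^P + 1)·2^k` quanta: `t = 2^m`, `2δ = ` spacing of `ψ` at `μ`
  have ht : Even (2 ^ φ.manBits) := Nat.even_pow.mpr ⟨even_two, by omega⟩
  have hthi : 2 ^ φ.manBits < 2 ^ (φ.manBits + 1) := Nat.pow_lt_pow_right (by norm_num) (by omega)
  have hk' : ψ.manBits ≤ φ.manBits + k + (φ.qexp - ψ.qexp).toNat := by omega
  have hP2 : φ.manBits + 2 ≤ ψ.manBits := by omega
  have hδψ : 2 * (2 ^ (φ.manBits + k + D' + 1) * ψ.quantum)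
      = 2 ^ (φ.manBits + k + (φ.qexp - ψ.qexp).toNat + 1 - ψ.manBits) * ψ.quantum := by
    rw [show φ.manBits + k + (φ.qexp - ψ.qexp).toNat + 1 - ψ.manBits
      = (φ.manBits + k + D' + 1) + 1 by omega, pow_succ]
    ring
  -- the significands
  rw [Bool.or_eq_true] at hs
  have h2m : 2 * (φ.manBits + 1) - 1 = 2 * φ.manBits + 1 := by omega
  rw [h2m] at hs
  have hdat : ∀ {a₁ b₁ : ℕ}, 0 < a₁ → a₁ < 2 ^ (φ.manBits + 1) → b₁ < 2 ^ (φ.manBits + 1) →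
      ∃ a b : MiniFloat φ, a.toRat = ((a₁ * 2 ^ s : ℕ) : ℚ) * φ.quantum
        ∧ b.toRat = (b₁ : ℚ) * φ.quantum := by
    intro a₁ b₁ ha0 ha hb
    have hak : a₁ * 2 ^ s ≤ φ.maxScaled := le_trans (Nat.mul_le_mul_right _ ha.le) has
    have hb1 : b₁ ≤ φ.maxScaled :=
      le_trans hb.le (le_trans (Nat.le_mul_of_pos_right _ (Nat.two_pow_pos s)) has)
    obtain ⟨a, ha'⟩ := exists_toRat_eq_natMul (representable_mul_pow ha hak)
    obtain ⟨b, hb'⟩ := exists_toRat_eq_natMul (representable_of_lt_pow hb hb1)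
    exact ⟨a, b, ha', hb'⟩
  have hm1 : 2 ^ φ.manBits + 1 < 2 ^ (φ.manBits + 1) := by
    have := Nat.one_lt_two_pow (n := φ.manBits) (by omega); rw [pow_succ]; omega
  intro hD
  rcases hs with hs | hs
  · -- `2^(2P-1) - 1 = a₁ b₁`: `a = -a₁·2^s`, `b = b₁`, `c = u = (2^m+1)·2^(k+1)` (quanta)
    obtain ⟨a₁, b₁, ha0, ha₁lt, hb₁lt, hab⟩ := exists_mul_of_twoSigTest hs
    obtain ⟨a, b, ha', hb'⟩ := hdat ha0 ha₁lt hb₁lt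
    obtain ⟨c, hc'⟩ := exists_toRat_eq_natMul (representable_mul_pow hm1 hu)
    have hN : (a₁ : ℚ) * b₁ = 2 ^ (2 * φ.manBits + 1) - 1 := by
      have h2 := congrArg (Nat.cast : ℕ → ℚ) hab
      rw [Nat.cast_sub Nat.one_le_two_pow] at h2; push_cast at h2; linarith
    have e : a.flipSign.toRat * b.toRat + c.toRat
        = (((2 * 2 ^ φ.manBits + 1) * 2 ^ k : ℕ) : ℚ) * φ.quantum
          + 2 ^ (φ.manBits + k + D' + 1) * ψ.quantum := by
      rw [toRat_flipSign, ha', hb', hc']; push_cast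
      linear_combination (-(a₁ : ℚ) * b₁ * 2 ^ s) * hSq + (-(a₁ : ℚ) * b₁ * ψ.quantum) * hsS
        + (-(2 : ℚ) ^ (φ.manBits + k + D' + 1) * ψ.quantum) * hN + (2 : ℚ) ^ k * hDq
    have h' := hD a.flipSign b c
    rw [e] at h'
    exact roundNE_roundNE_ne_gmid_tie hq hM h1 hP2 ht le_rfl hthi hu hk' hδψ h'
  · -- `2^(2P-1) + 1 = a₁ b₁`: `a = a₁·2^s`, `b = b₁`, `c = v = 2^m·2^(k+1)` (quanta)
    obtain ⟨a₁, b₁, ha0, ha₁lt, hb₁lt, hab⟩ := exists_mul_of_twoSigTest hs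
    obtain ⟨a, b, ha', hb'⟩ := hdat ha0 ha₁lt hb₁lt
    obtain ⟨c, hc'⟩ := exists_toRat_eq_natMul
      (representable_mul_pow hthi (le_trans (Nat.mul_le_mul_right _ (Nat.le_succ _)) hu))
    have hN : (a₁ : ℚ) * b₁ = 2 ^ (2 * φ.manBits + 1) + 1 := by exact_mod_cast hab.symm
    have e : a.toRat * b.toRat + c.toRat
        = (((2 * 2 ^ φ.manBits + 1) * 2 ^ k : ℕ) : ℚ) * φ.quantum
          + 2 ^ (φ.manBits + k + D' + 1) * ψ.quantum := by
      rw [ha', hb', hc']; push_cast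
      linear_combination ((a₁ : ℚ) * b₁ * 2 ^ s) * hSq + ((a₁ : ℚ) * b₁ * ψ.quantum) * hsS
        + ((2 : ℚ) ^ (φ.manBits + k + D' + 1) * ψ.quantum) * hN + (-(2 : ℚ) ^ k) * hDq
    have h' := hD a b c
    rw [e] at h'
    exact roundNE_roundNE_ne_gmid_tie hq hM h1 hP2 ht le_rfl hthi hu hk' hδψ h'

end Summit.Ventures.CertifiedArithmetic
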